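import Summits.BirchSwinnertonDyer.Rank1Residual.X11b.CongruentSelmerTransferLocalLeGlue
import Literature.NumberTheory.EllipticCurves.Fisher2016.CongruentKummerConditions
import HarnessLib

/-!
# The `(d3)`/`(u3)` disjuncts at `v = p` for a congruent pair NON-SPLIT MULTIPLICATIVE vs GOOD above `p`
# (class X11b, cell `b2b-bsdres`, unit `b2b-bsdres-sha-2`, gen 34; part (e7))

HONEST FRAMING (run/shared/lean/b2b/bsd-rank1-residual/, verbatim in every file): prove what is
provable now; shrink each hard class to its core with data; no claim beyond stated classes.
EVIDENCE-grade, staged by the sha-2 instrument seat for ADOPT-AND-FILE by a filing seat; nothing is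
booked; no named fact is added; no label moves.

The one-directional consumer `X11b/CongruentSelmerTransferLocalLeRat.lean`
(`bsdp_of_congruent_*_localLe`) takes, per place `v` of the check set, EITHER the Gross–Parson
numerals (d1) OR the local inclusion (d3) `∀ θ equivariant, c ∈ 𝓢_v(W) → θ_* c ∈ 𝓢_v(Y)` (and (u3),
the converse orientation, for rule R7). The glue file `X11b/CongruentSelmerTransferLocalLeGlue.lean`
serves the kind "one curve non-split multiplicative, the other good" only OFF `p`
(`localLe_of_nonsplit_good` / `localLe_of_good_nonsplit`, hypothesis `p ≠ ℓ`, through the X11a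
theorems and A41). AT `v = p` the same kind is exactly the registered named fact **A46**
`Literature.NumberTheory.EllipticCurves.Fisher2016.thm44_selmerLocalKer_iff_of_nonsplit_good`
(T. Fisher, LMS J. Comput. Math. 19 (2016) Thm. 4.4, p. 106: for `ℓ`-congruent `E`, `F` over a
`p`-adic field `K` with `E` non-split multiplicative and `F` good, and `e(K/ℚ_p) < p − 1` when
`p = ℓ`, the Kummer images of `E(K)/ℓE(K)` and `F(K)/ℓF(K)` agree), whose over-`ℚ` corollary
`Fisher2016.selmerLocalKer_iff_of_nonsplit_good_rat` discharges the ramification clause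
(`e(ℚ_p/ℚ_p) = 1 < p − 1`, `p` odd) at ANY finite place. This file packages it in the consumer's
shape at the literal place `placeOf p` (hypothesis `hF` = A46, playing the role A308 `hMR` plays for
the both-good kind `localLe_of_good_good_above`):

* `localLe_of_nonsplit_good_above` — (d3) for `W` non-split multiplicative at `p`, `Y` good at `p`;
* `localLe_of_good_nonsplit_above` — (d3) for `W` good at `p`, `Y` non-split multiplicative at `p`;
* `localLe_pair_of_nonsplit_good_above_of_intModel` — both orientations at once from the two
  integer models with kernel-decidable certificates: `p ∣ Δ(E₀)`, `p ∤ c₄(E₀)` (multiplicative,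
  Silverman AEC VII.5.1(b)), the node-tangent quadratic
  `c₄t² + a₁c₄t − (54b₆ − 3b₂b₄ + a₂c₄)` of `E₀` root-free mod `p` (non-split;
  `IntModel.not_hasSplitMultiplicativeReductionAtPrime_of_intModel_of_noroot`), `p ∤ Δ(F₀)` (good).

References: T. Fisher, "Visualizing elements of order 7 in the Tate–Shafarevich group of an
elliptic curve", LMS J. Comput. Math. 19 (2016) 100–114, Thm. 4.4 [Fisher2016Visualizing7];
J. H. Silverman, AEC (2009) VII.5 Prop. 5.1 [SilvermanAEC2009].
-/

set_option autoImplicit false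

noncomputable section

open scoped Classical

open Field IsDedekindDomain NumberField Rat.HeightOneSpectrum WeierstrassCurve
  Literature.NumberTheory.EllipticCurves Literature.NumberTheory.GaloisRepresentations
  Literature.NumberTheory.GaloisCohomology
  Literature.NumberTheory.EllipticCurves.Rank1Residual
  Summit.BirchSwinnertonDyer.BirchSwinnertonDyer.Rank1Residual
  Summit.BirchSwinnertonDyer.Rank1Residual.GaloisImage
  Summit.BirchSwinnertonDyer.Rank1Residual.X11b.CongruentTransfer.Records
open scoped ContRepresentation

namespace Summit.BirchSwinnertonDyer.Rank1Residual.X11b.CongruentTransfer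

variable {p : ℕ} [hp : Fact p.Prime]

/-! ## §1 The kind lemmas at `placeOf p` (hypothesis `hF` = A46) -/

/-- **(d3) at the place over `p` (odd) where `W` is NON-SPLIT MULTIPLICATIVE and `Y` GOOD** — the
named fact A46 (Fisher 2016 Thm. 4.4; over `ℚ` the clause `e(K/ℚ_p) < p − 1` is automatic),
hypothesis `hF`. [cite: Fisher2016Visualizing7, Thm. 4.4 (p. 106)] -/
theorem localLe_of_nonsplit_good_above (hF : Fisher2016.thm44_selmerLocalKer_iff_of_nonsplit_good)
    (hp2 : p ≠ 2) (W Y : WeierstrassCurve ℚ) [W.IsElliptic] [Y.IsElliptic]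
    (hWm : W.HasMultiplicativeReductionAt (placeOf p))
    (hWns : ¬ W.HasSplitMultiplicativeReductionAt (placeOf p))
    (hY : Y.HasGoodReductionAt (placeOf p)) :
    ∀ (θ : geomTorsion W (p : ℤ) ≃+ geomTorsion Y (p : ℤ))
      (hθ : ∀ (σ : absoluteGaloisGroup ℚ) (P : geomTorsion W (p : ℤ)), θ (σ • P) = σ • θ P)
      (c : galoisCohomology (W.torsionGaloisModule (p : ℤ)) 1),
      c ∈ selmerLocalKer W ((placeOf p).adicCompletion ℚ) (p : ℤ) →
        h1Equiv θ hθ c ∈ selmerLocalKer Y ((placeOf p).adicCompletion ℚ) (p : ℤ) :=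
  fun θ hθ c hc => (Fisher2016.selmerLocalKer_iff_of_nonsplit_good_rat hF Y W hp2 θ hθ (placeOf p)
    (Or.inr ⟨hY, hWm, hWns⟩) c).mp hc

/-- **(d3) at the place over `p` (odd) where `W` is GOOD and `Y` NON-SPLIT MULTIPLICATIVE** — the
named fact A46 (Fisher 2016 Thm. 4.4), hypothesis `hF`. [cite: Fisher2016Visualizing7, Thm. 4.4 (p. 106)] -/
theorem localLe_of_good_nonsplit_above (hF : Fisher2016.thm44_selmerLocalKer_iff_of_nonsplit_good)
    (hp2 : p ≠ 2) (W Y : WeierstrassCurve ℚ) [W.IsElliptic] [Y.IsElliptic]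
    (hW : W.HasGoodReductionAt (placeOf p)) (hYm : Y.HasMultiplicativeReductionAt (placeOf p))
    (hYns : ¬ Y.HasSplitMultiplicativeReductionAt (placeOf p)) :
    ∀ (θ : geomTorsion W (p : ℤ) ≃+ geomTorsion Y (p : ℤ))
      (hθ : ∀ (σ : absoluteGaloisGroup ℚ) (P : geomTorsion W (p : ℤ)), θ (σ • P) = σ • θ P)
      (c : galoisCohomology (W.torsionGaloisModule (p : ℤ)) 1),
      c ∈ selmerLocalKer W ((placeOf p).adicCompletion ℚ) (p : ℤ) →
        h1Equiv θ hθ c ∈ selmerLocalKer Y ((placeOf p).adicCompletion ℚ) (p : ℤ) :=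
  fun θ hθ c hc => (Fisher2016.selmerLocalKer_iff_of_nonsplit_good_rat hF Y W hp2 θ hθ (placeOf p)
    (Or.inl ⟨hYm, hYns, hW⟩) c).mp hc

/-! ## §2 The integer-model certificates at `placeOf ℓ` -/

/-- **Multiplicative reduction at `placeOf ℓ`** from `ℓ ∣ Δ(E₀)`, `ℓ ∤ c₄(E₀)` (globally minimal
integer model). [cite: SilvermanAEC2009, VII.5 Prop. 5.1(b)] -/
theorem hasMultiplicativeReductionAt_placeOf_of_intModel (W : WeierstrassCurve ℚ) [W.IsElliptic]
    [W.IsGloballyMinimal] {E₀ : WeierstrassCurve ℤ} (hI : integralModelInt W = E₀) (ℓ : ℕ)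
    [Fact ℓ.Prime] (hΔ : (ℓ : ℤ) ∣ E₀.Δ) (hc₄ : ¬ (ℓ : ℤ) ∣ E₀.c₄) :
    W.HasMultiplicativeReductionAt (placeOf ℓ) := by
  refine W.hasMultiplicativeReductionAt_of_dvd_of_not_dvd (placeOf ℓ) ?_ ?_
  · rw [primesEquiv_placeOf, IntModel.minimalDiscriminantInt_eq hI]; exact hΔ
  · rw [primesEquiv_placeOf, hI]; exact hc₄

/-- **NOT split multiplicative at `placeOf ℓ`** from the integer model: `ℓ ∣ Δ(E₀)`, `ℓ ∤ c₄(E₀)`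
and the node-tangent quadratic of `E₀` root-free mod `ℓ` (the tree's
`IntModel.not_hasSplitMultiplicativeReductionAtPrime_of_intModel_of_noroot`, moved to the place by
`hasSplitMultiplicativeReductionAtPrime_iff_hasSplitMultiplicativeReductionAt`).
[cite: SilvermanAEC2009, VII.5 Prop. 5.1(b)] -/
theorem not_hasSplitMultiplicativeReductionAt_placeOf_of_intModel (W : WeierstrassCurve ℚ)
    [W.IsElliptic] [W.IsGloballyMinimal] {E₀ : WeierstrassCurve ℤ} (hI : integralModelInt W = E₀)
    (ℓ : ℕ) [hℓ : Fact ℓ.Prime] (hΔ : (ℓ : ℤ) ∣ E₀.Δ) (hc₄ : ¬ (ℓ : ℤ) ∣ E₀.c₄)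
    (hnoroot : ∀ t : ZMod ℓ, (E₀.c₄ : ZMod ℓ) * t ^ 2 + (E₀.a₁ * E₀.c₄ : ZMod ℓ) * t
      - (54 * E₀.b₆ - 3 * E₀.b₂ * E₀.b₄ + E₀.a₂ * E₀.c₄ : ZMod ℓ) ≠ 0) :
    ¬ W.HasSplitMultiplicativeReductionAt (placeOf ℓ) := by
  have h1 := IntModel.not_hasSplitMultiplicativeReductionAtPrime_of_intModel_of_noroot hI ℓ hΔ hc₄
    hnoroot
  have key : ∀ q : Nat.Primes, primesEquiv (placeOf ℓ) = q →
      ((haveI := Fact.mk q.2; W.HasSplitMultiplicativeReductionAtPrime (q : ℕ)) ↔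
        W.HasSplitMultiplicativeReductionAt (placeOf ℓ)) := by
    rintro q rfl
    exact hasSplitMultiplicativeReductionAtPrime_iff_hasSplitMultiplicativeReductionAt W (placeOf ℓ)
  have hq : primesEquiv (placeOf ℓ) = ⟨ℓ, hℓ.out⟩ := Subtype.ext (primesEquiv_placeOf ℓ)
  rw [← key _ hq]
  exact h1

/-! ## §3 Both orientations at `placeOf p` from the two integer models -/

/-- **(d3) ∧ (u3) at `v = p` (odd), `W` NON-SPLIT MULTIPLICATIVE and `Y` GOOD at `p`, from the integer
models** — certificates `p ∣ Δ(E₀)`, `p ∤ c₄(E₀)`, node-tangent quadratic of `E₀` root-free mod `p`,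
`p ∤ Δ(F₀)` (all `decide` on literal integers); conditional on A46 `hF`.
[cite: Fisher2016Visualizing7, Thm. 4.4 (p. 106)] [cite: SilvermanAEC2009, VII.5 Prop. 5.1] -/
theorem localLe_pair_of_nonsplit_good_above_of_intModel
    (hF : Fisher2016.thm44_selmerLocalKer_iff_of_nonsplit_good) (hp2 : p ≠ 2)
    (W Y : WeierstrassCurve ℚ) [W.IsElliptic] [W.IsGloballyMinimal] [Y.IsElliptic]
    [Y.IsGloballyMinimal] {E₀ F₀ : WeierstrassCurve ℤ} (hW : integralModelInt W = E₀)
    (hY : integralModelInt Y = F₀) (hΔ : (p : ℤ) ∣ E₀.Δ) (hc₄ : ¬ (p : ℤ) ∣ E₀.c₄)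
    (hnoroot : ∀ t : ZMod p, (E₀.c₄ : ZMod p) * t ^ 2 + (E₀.a₁ * E₀.c₄ : ZMod p) * t
      - (54 * E₀.b₆ - 3 * E₀.b₂ * E₀.b₄ + E₀.a₂ * E₀.c₄ : ZMod p) ≠ 0)
    (hΔY : ¬ (p : ℤ) ∣ F₀.Δ) :
    (∀ (θ : geomTorsion W (p : ℤ) ≃+ geomTorsion Y (p : ℤ))
        (hθ : ∀ (σ : absoluteGaloisGroup ℚ) (P : geomTorsion W (p : ℤ)), θ (σ • P) = σ • θ P)
        (c : galoisCohomology (W.torsionGaloisModule (p : ℤ)) 1),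
        c ∈ selmerLocalKer W ((placeOf p).adicCompletion ℚ) (p : ℤ) →
          h1Equiv θ hθ c ∈ selmerLocalKer Y ((placeOf p).adicCompletion ℚ) (p : ℤ)) ∧
      ∀ (θ : geomTorsion Y (p : ℤ) ≃+ geomTorsion W (p : ℤ))
        (hθ : ∀ (σ : absoluteGaloisGroup ℚ) (P : geomTorsion Y (p : ℤ)), θ (σ • P) = σ • θ P)
        (c : galoisCohomology (Y.torsionGaloisModule (p : ℤ)) 1),
        c ∈ selmerLocalKer Y ((placeOf p).adicCompletion ℚ) (p : ℤ) →
          h1Equiv θ hθ c ∈ selmerLocalKer W ((placeOf p).adicCompletion ℚ) (p : ℤ) :=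
  have hWm := hasMultiplicativeReductionAt_placeOf_of_intModel W hW p hΔ hc₄
  have hWns := not_hasSplitMultiplicativeReductionAt_placeOf_of_intModel W hW p hΔ hc₄ hnoroot
  have hYg := hasGoodReductionAt_placeOf_of_not_dvd Y hY p hΔY
  ⟨localLe_of_nonsplit_good_above hF hp2 W Y hWm hWns hYg,
    localLe_of_good_nonsplit_above hF hp2 Y W hYg hWm hWns⟩

/-- The mirror pair: `W` GOOD and `Y` NON-SPLIT MULTIPLICATIVE at `p` (odd), from the integer models;
conditional on A46 `hF`. [cite: Fisher2016Visualizing7, Thm. 4.4 (p. 106)] [cite: SilvermanAEC2009, VII.5 Prop. 5.1] -/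
theorem localLe_pair_of_good_nonsplit_above_of_intModel
    (hF : Fisher2016.thm44_selmerLocalKer_iff_of_nonsplit_good) (hp2 : p ≠ 2)
    (W Y : WeierstrassCurve ℚ) [W.IsElliptic] [W.IsGloballyMinimal] [Y.IsElliptic]
    [Y.IsGloballyMinimal] {E₀ F₀ : WeierstrassCurve ℤ} (hW : integralModelInt W = E₀)
    (hY : integralModelInt Y = F₀) (hΔW : ¬ (p : ℤ) ∣ E₀.Δ) (hΔ : (p : ℤ) ∣ F₀.Δ)
    (hc₄ : ¬ (p : ℤ) ∣ F₀.c₄)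
    (hnoroot : ∀ t : ZMod p, (F₀.c₄ : ZMod p) * t ^ 2 + (F₀.a₁ * F₀.c₄ : ZMod p) * t
      - (54 * F₀.b₆ - 3 * F₀.b₂ * F₀.b₄ + F₀.a₂ * F₀.c₄ : ZMod p) ≠ 0) :
    (∀ (θ : geomTorsion W (p : ℤ) ≃+ geomTorsion Y (p : ℤ))
        (hθ : ∀ (σ : absoluteGaloisGroup ℚ) (P : geomTorsion W (p : ℤ)), θ (σ • P) = σ • θ P)
        (c : galoisCohomology (W.torsionGaloisModule (p : ℤ)) 1),
        c ∈ selmerLocalKer W ((placeOf p).adicCompletion ℚ) (p : ℤ) →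
          h1Equiv θ hθ c ∈ selmerLocalKer Y ((placeOf p).adicCompletion ℚ) (p : ℤ)) ∧
      ∀ (θ : geomTorsion Y (p : ℤ) ≃+ geomTorsion W (p : ℤ))
        (hθ : ∀ (σ : absoluteGaloisGroup ℚ) (P : geomTorsion Y (p : ℤ)), θ (σ • P) = σ • θ P)
        (c : galoisCohomology (Y.torsionGaloisModule (p : ℤ)) 1),
        c ∈ selmerLocalKer Y ((placeOf p).adicCompletion ℚ) (p : ℤ) →
          h1Equiv θ hθ c ∈ selmerLocalKer W ((placeOf p).adicCompletion ℚ) (p : ℤ) :=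
  have h := localLe_pair_of_nonsplit_good_above_of_intModel hF hp2 Y W hY hW hΔ hc₄ hnoroot hΔW
  ⟨h.2, h.1⟩

end Summit.BirchSwinnertonDyer.Rank1Residual.X11b.CongruentTransfer

end
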